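import Literature.NumberTheory.ComplexMultiplication.CMOrderIdealClassMonoidCountFormula
import Literature.NumberTheory.ComplexMultiplication.CMTorusIsomorphismClassesMaximalEndomorphismRingCount
import Literature.NumberTheory.ComplexMultiplication.CMOrderBassClifford
import HarnessLib

/-!
# Validation on `ℚ(ζ₃)`, `𝔯 = ℤ[√-3]`: the two classes of CM tori with multiplication by `ℤ[√-3]` split as
# ONE with endomorphism ring exactly `ℤ[√-3]` and ONE with endomorphism ring `ℤ[ζ₃] = 𝓞_K`

Layer A3 of the Hodge/CM programme (docs/m5/MAPPING.md §1) — the lane's running example `EisensteinTwo`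
(`K₃ = ℚ(ζ₃)`, `basis = (1, 2ζ₃)` spanning the order `ℤ[2ζ₃] = ℤ[√-3]` of conductor `2`, `maximalBasis = (1, ζ₃)`
spanning `𝓞_K = ℤ[ζ₃]`).  `CMTorusIsomorphismClassesOrderFinite` §4 counted TWO `K`-isomorphism classes of CM tori
`ℂ/Φ(𝔪)` with multiplication by `ℤ[√-3]` (`#ICM(ℤ[√-3]) = 2`).  The exact-order machinery of this generation
(`CMTorusIsomorphismClassesExactOrderCount`, `CMOrderOverorderPicardClasses`,
`CMTorusIsomorphismClassesMaximalEndomorphismRingCount`, `CMOrderIdealClassMonoidCountFormula`) resolves them: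

* `natCard_quot_exists_bijective_comm_endOrder_eq_basis_eq_one` — exactly ONE class has endomorphism ring EXACTLY
  `ℤ[√-3]` (`ℤ[√-3]` is Gorenstein — quadratic — and `#Pic(ℤ[√-3]) = 1`): the curve `y² = x³ − 15x + 22`-type class;
* `natCard_quot_exists_bijective_comm_endOrder_eq_range_eq_one` / `…_eq_maximalBasis_eq_one` — exactly ONE class has
  endomorphism ring `𝓞_K = ℤ[ζ₃]` (`h(ℚ(ζ₃)) = 1`, Shimura's Prop. 17 inside the `ℤ[√-3]`-family);
* `natCard_quot_exists_bijective_comm_eq_natCard_add_natCard` — `2 = 1 + 1`, the partition by endomorphism rings;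
* `natCard_quot_stratum_weak_eq_one_of_overorder_basis` — every over-order of `ℤ[√-3]` has `#W̄k = 1` (Bass), and
  `sum_overorders_natCard_classGroup_eq_natCard_quot_exists_bijective_comm` — `Σ_S #Pic(S) = #` classes of tori.

Theorems only (no new definitions, no named facts).

## References
* [Shimura1998] G. Shimura, *Abelian varieties with complex multiplication and modular functions*, PUP 1998 —
  §7.4 Prop. 17, p. 58.
* [Cox2013] D. A. Cox, *Primes of the form x² + ny²*, 2nd ed., Wiley 2013 — §7.A Lemma 7.2, §10.C Cor. 10.20,
  §12 (`h(-3) = h(-12) = 1`), pp. 133, 208.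
* [Marseglia2019] S. Marseglia, *Computing the ideal class monoid of an order*, J. Lond. Math. Soc. 101 (2020),
  arXiv:1805.09671 — §2 after Cor. 2.11 («every order in a quadratic field is a Bass order»), §4 Thm. 4.6, pp. 5, 9.
* [Stevenhagen2008NumberRings] P. Stevenhagen, *The arithmetic of number rings*, MSRI Publ. 44 (2008) — Example 6.9, p. 226.
-/

noncomputable section

open scoped Classical nonZeroDivisors NumberField Pointwise
open NumberField Module FractionalIdeal

namespace Literature.NumberTheory.ComplexMultiplication

open Literature.AlgebraicGeometry.Motives (CMType)
open Literature.AlgebraicGeometry.ComplexMultiplication (CMTorus.periodEquiv)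
open Literature.Geometry.Kaehler
open Literature.Geometry.Kaehler.ComplexTorus (mapMatrix)

namespace CMTypeLattice

namespace EisensteinTwo

/-- **`ℤ[ζ₃] = 𝓞_K` as an order of the series**: `endOrder (M_{(1, ζ₃)}) = 𝓞_{ℚ(ζ₃)}`.
[cite: Cox2013, §7.A Lemma 7.2 (`𝒪_K = [1, w_K]`), p. 133] [cite: Stevenhagen2008NumberRings, Example 6.9 («`𝒪 = ℤ[ω]`»), p. 226] -/
theorem endOrder_maximalBasis_eq_range :
    endOrder (Algebra.leftMulMatrix maximalBasis) = (algebraMap (𝓞 K₃) K₃).range :=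
  le_antisymm (endOrder_le_range _) (by
    rintro _ ⟨a, rfl⟩
    exact coe_ringOfIntegers_mem_endOrder_maximalBasis a)

/-- **Exactly ONE `K`-isomorphism class of CM tori `ℂ/Φ(𝔪)` of `ℚ(ζ₃)` with multiplication by `ℤ[√-3]` has
endomorphism ring EXACTLY `ℤ[√-3]`** (`= #W̄k(ℤ[√-3]) · #Pic(ℤ[√-3]) = 1 · 1`: the quadratic order `ℤ[√-3]` is
Gorenstein and `#Pic(ℤ[√-3]) = 1`). [cite: Cox2013, §10.C Cor. 10.20 and §7 (`h(-12) = 1`), p. 208]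
[cite: Marseglia2019, §4 Thm. 4.6 and §2 after Cor. 2.11, pp. 5, 9] -/
theorem natCard_quot_exists_bijective_comm_endOrder_eq_basis_eq_one (Φ : CMType K₃) :
    Nat.card (Quot fun μ μ' : {μ : Basis (Fin 2) ℚ K₃ //
        endOrder (Algebra.leftMulMatrix basis) ≤ endOrder (Algebra.leftMulMatrix μ) ∧
          endOrder (Algebra.leftMulMatrix μ) = endOrder (Algebra.leftMulMatrix basis)} =>
      ∃ A : Matrix (Fin 2) (Fin 2) ℤ,
        Function.Bijective (mapMatrix (CMTorus.periodEquiv Φ (μ : Basis (Fin 2) ℚ K₃))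
            (CMTorus.periodEquiv Φ (μ' : Basis (Fin 2) ℚ K₃)) A) ∧
          ∀ α : K₃, A.map (Int.cast : ℤ → ℚ) * Algebra.leftMulMatrix (μ : Basis (Fin 2) ℚ K₃) α =
            Algebra.leftMulMatrix (μ' : Basis (Fin 2) ℚ K₃) α * A.map (Int.cast : ℤ → ℚ)) = 1 := by
  have h1 : (1 : FractionalIdeal (endOrder (Algebra.leftMulMatrix basis))⁰ K₃) ≠ 0 :=
    one_ne_zero' (FractionalIdeal (endOrder (Algebra.leftMulMatrix basis))⁰ K₃)
  rw [(natCard_quot_exists_bijective_comm_eq_natCard_classGroup_iff_forall_div_div_eq basis basis Φ le_rfl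
      (one_mul 1) h1 (coe_one_eq_coe_endOrder basis)).2 fun I hI hMI =>
      div_div_eq_of_finrank_eq_two basis (one_mul 1) h1 hI hMI,
    natCard_classGroup_eq_one]

/-- **Exactly ONE class (in the `ℤ[√-3]`-family) has endomorphism ring the MAXIMAL order `𝓞_K`** — Shimura's
PROPOSITION 17 (`h = h(ℚ(ζ₃)) = 1`, Mathlib's `IsCyclotomicExtension.Rat.three_pid`) inside the family of the
non-maximal order `ℤ[√-3]`. [cite: Shimura1998, §7.4 Prop. 17, p. 58] [cite: Cox2013, §12 (`h(-3) = 1`)] -/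
theorem natCard_quot_exists_bijective_comm_endOrder_eq_range_eq_one (Φ : CMType K₃) :
    Nat.card (Quot fun μ μ' : {μ : Basis (Fin 2) ℚ K₃ //
        endOrder (Algebra.leftMulMatrix basis) ≤ endOrder (Algebra.leftMulMatrix μ) ∧
          endOrder (Algebra.leftMulMatrix μ) = (algebraMap (𝓞 K₃) K₃).range} =>
      ∃ A : Matrix (Fin 2) (Fin 2) ℤ,
        Function.Bijective (mapMatrix (CMTorus.periodEquiv Φ (μ : Basis (Fin 2) ℚ K₃))
            (CMTorus.periodEquiv Φ (μ' : Basis (Fin 2) ℚ K₃)) A) ∧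
          ∀ α : K₃, A.map (Int.cast : ℤ → ℚ) * Algebra.leftMulMatrix (μ : Basis (Fin 2) ℚ K₃) α =
            Algebra.leftMulMatrix (μ' : Basis (Fin 2) ℚ K₃) α * A.map (Int.cast : ℤ → ℚ)) = 1 := by
  rw [natCard_quot_exists_bijective_comm_range_eq_classNumber basis Φ]
  haveI := IsCyclotomicExtension.Rat.three_pid K₃
  exact classNumber_eq_one_iff.mpr inferInstance

/-- The same with the maximal order presented as the order of the lattice `ℤ·1 ⊕ ℤ·ζ₃`: **exactly ONE class has
endomorphism ring `ℤ[ζ₃]`.** [cite: Shimura1998, §7.4 Prop. 17, p. 58] [cite: Cox2013, §7.A Lemma 7.2, p. 133] -/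
theorem natCard_quot_exists_bijective_comm_endOrder_eq_maximalBasis_eq_one (Φ : CMType K₃) :
    Nat.card (Quot fun μ μ' : {μ : Basis (Fin 2) ℚ K₃ //
        endOrder (Algebra.leftMulMatrix basis) ≤ endOrder (Algebra.leftMulMatrix μ) ∧
          endOrder (Algebra.leftMulMatrix μ) = endOrder (Algebra.leftMulMatrix maximalBasis)} =>
      ∃ A : Matrix (Fin 2) (Fin 2) ℤ,
        Function.Bijective (mapMatrix (CMTorus.periodEquiv Φ (μ : Basis (Fin 2) ℚ K₃))
            (CMTorus.periodEquiv Φ (μ' : Basis (Fin 2) ℚ K₃)) A) ∧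
          ∀ α : K₃, A.map (Int.cast : ℤ → ℚ) * Algebra.leftMulMatrix (μ : Basis (Fin 2) ℚ K₃) α =
            Algebra.leftMulMatrix (μ' : Basis (Fin 2) ℚ K₃) α * A.map (Int.cast : ℤ → ℚ)) = 1 := by
  rw [endOrder_maximalBasis_eq_range]
  exact natCard_quot_exists_bijective_comm_endOrder_eq_range_eq_one Φ

/-- **`2 = 1 + 1`: the two classes with multiplication by `ℤ[√-3]` are ONE with endomorphism ring `ℤ[√-3]` and
ONE with endomorphism ring `ℤ[ζ₃]`** (the partition of the classes by their endomorphism order, here with the two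
over-orders `ℤ[√-3] ⊂ ℤ[ζ₃]`). [cite: Cox2013, §10.C Cor. 10.20, p. 208] [cite: Marseglia2019, §4 («`ICM(R) = ⊔ ICM_S`»), p. 9] -/
theorem natCard_quot_exists_bijective_comm_eq_natCard_add_natCard (Φ : CMType K₃) :
    Nat.card (Quot fun μ μ' : {μ : Basis (Fin 2) ℚ K₃ //
        endOrder (Algebra.leftMulMatrix basis) ≤ endOrder (Algebra.leftMulMatrix μ)} =>
      ∃ A : Matrix (Fin 2) (Fin 2) ℤ,
        Function.Bijective (mapMatrix (CMTorus.periodEquiv Φ (μ : Basis (Fin 2) ℚ K₃))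
            (CMTorus.periodEquiv Φ (μ' : Basis (Fin 2) ℚ K₃)) A) ∧
          ∀ α : K₃, A.map (Int.cast : ℤ → ℚ) * Algebra.leftMulMatrix (μ : Basis (Fin 2) ℚ K₃) α =
            Algebra.leftMulMatrix (μ' : Basis (Fin 2) ℚ K₃) α * A.map (Int.cast : ℤ → ℚ)) =
    Nat.card (Quot fun μ μ' : {μ : Basis (Fin 2) ℚ K₃ //
        endOrder (Algebra.leftMulMatrix basis) ≤ endOrder (Algebra.leftMulMatrix μ) ∧
          endOrder (Algebra.leftMulMatrix μ) = endOrder (Algebra.leftMulMatrix basis)} =>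
      ∃ A : Matrix (Fin 2) (Fin 2) ℤ,
        Function.Bijective (mapMatrix (CMTorus.periodEquiv Φ (μ : Basis (Fin 2) ℚ K₃))
            (CMTorus.periodEquiv Φ (μ' : Basis (Fin 2) ℚ K₃)) A) ∧
          ∀ α : K₃, A.map (Int.cast : ℤ → ℚ) * Algebra.leftMulMatrix (μ : Basis (Fin 2) ℚ K₃) α =
            Algebra.leftMulMatrix (μ' : Basis (Fin 2) ℚ K₃) α * A.map (Int.cast : ℤ → ℚ)) +
    Nat.card (Quot fun μ μ' : {μ : Basis (Fin 2) ℚ K₃ //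
        endOrder (Algebra.leftMulMatrix basis) ≤ endOrder (Algebra.leftMulMatrix μ) ∧
          endOrder (Algebra.leftMulMatrix μ) = endOrder (Algebra.leftMulMatrix maximalBasis)} =>
      ∃ A : Matrix (Fin 2) (Fin 2) ℤ,
        Function.Bijective (mapMatrix (CMTorus.periodEquiv Φ (μ : Basis (Fin 2) ℚ K₃))
            (CMTorus.periodEquiv Φ (μ' : Basis (Fin 2) ℚ K₃)) A) ∧
          ∀ α : K₃, A.map (Int.cast : ℤ → ℚ) * Algebra.leftMulMatrix (μ : Basis (Fin 2) ℚ K₃) α =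
            Algebra.leftMulMatrix (μ' : Basis (Fin 2) ℚ K₃) α * A.map (Int.cast : ℤ → ℚ)) := by
  rw [natCard_quot_exists_bijective_comm_eq_two, natCard_quot_exists_bijective_comm_endOrder_eq_basis_eq_one,
    natCard_quot_exists_bijective_comm_endOrder_eq_maximalBasis_eq_one]

/-- **Every over-order `S` of `ℤ[√-3]` has a single weak class, `#W̄k(S) = 1`** (quadratic orders are Bass: all
over-orders Gorenstein). [cite: Marseglia2019, §2 after Cor. 2.11 and §4 remark after Def. 4.2, pp. 5, 8] -/
theorem natCard_quot_stratum_weak_eq_one_of_overorder_basis {S : Subring K₃}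
    (h𝔬S : endOrder (Algebra.leftMulMatrix basis) ≤ S) (hfin : Module.Finite ℤ S) :
    Nat.card (Quot fun M N : {M : FractionalIdeal (endOrder (Algebra.leftMulMatrix basis))⁰ K₃ //
        M ≠ 0 ∧ ((M / M : FractionalIdeal (endOrder (Algebra.leftMulMatrix basis))⁰ K₃) : Set K₃) = S} =>
      (1 : K₃) ∈ (M : FractionalIdeal (endOrder (Algebra.leftMulMatrix basis))⁰ K₃) / N * (N / M)) = 1 :=
  (natCard_quot_stratum_weak_eq_one_iff_of_overorder basis h𝔬S hfin).2 fun _ hM0 hMM _ _ hI hMI =>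
    div_div_eq_of_finrank_eq_two basis hMM hM0 hI hMI

/-- **`Σ_S #Pic(S) = #` classes of CM tori with multiplication by `ℤ[√-3]`** — the equality case «`𝔯` Bass» of
`CMOrderIdealClassMonoidCountFormula.sum_natCard_classGroup_eq_natCard_quot_exists_bijective_comm_iff`
(both sides are `2`: `CMOrderIdealClassMonoidOverorderCount.EisensteinTwo.sum_overorders_natCard_classGroup_eq_two`).
[cite: Marseglia2019, §3 Prop. 3.7, p. 6] [cite: Cox2013, §10.C Cor. 10.20, p. 208] -/
theorem sum_overorders_natCard_classGroup_eq_natCard_quot_exists_bijective_comm (Φ : CMType K₃) :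
    ∑ S ∈ (EndOrder.finite_setOf_overorder (ρ := Algebra.leftMulMatrix basis) (K := K₃)).toFinset,
        Nat.card (ClassGroup S) =
      Nat.card (Quot fun μ μ' : {μ : Basis (Fin 2) ℚ K₃ //
          endOrder (Algebra.leftMulMatrix basis) ≤ endOrder (Algebra.leftMulMatrix μ)} =>
        ∃ A : Matrix (Fin 2) (Fin 2) ℤ,
          Function.Bijective (mapMatrix (CMTorus.periodEquiv Φ (μ : Basis (Fin 2) ℚ K₃))
              (CMTorus.periodEquiv Φ (μ' : Basis (Fin 2) ℚ K₃)) A) ∧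
            ∀ α : K₃, A.map (Int.cast : ℤ → ℚ) * Algebra.leftMulMatrix (μ : Basis (Fin 2) ℚ K₃) α =
              Algebra.leftMulMatrix (μ' : Basis (Fin 2) ℚ K₃) α * A.map (Int.cast : ℤ → ℚ)) :=
  (sum_natCard_classGroup_eq_natCard_quot_exists_bijective_comm_iff basis Φ).2 fun _ hM0 hMM _ hI hMI =>
    div_div_eq_of_finrank_eq_two basis hMM hM0 hI hMI

end EisensteinTwo

end CMTypeLattice

end Literature.NumberTheory.ComplexMultiplication
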